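import Summits.ValiantsHypothesis.ValiantsHypothesis.Theorems.BarrierLeverSuccinctHittingSetsForVPUniversalJoint
import Literature.Barriers.ValiantsHypothesis.AlgebraicNaturalProofsGenerators
import Literature.Barriers.ValiantsHypothesis.AlgebraicNaturalProofsPlanting

/-!
# Crux `BarrierLever.SuccinctHittingSetsForVP` (stmt-ValiantsHypothesis-14610) — universal jointness in
# the door's vocabulary (`JointlySuccinct`, `IsHittingSetGenerator`)

`…UniversalJoint.universalJointness` spelled out the bodies of
`Literature.Barriers.ValiantsHypothesis.JointlySuccinct` (`AlgebraicNaturalProofsPlanting.lean`) and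
`Literature.Barriers.ValiantsHypothesis.IsHittingSetGenerator` (`AlgebraicNaturalProofsGenerators.lean`)
so that it could be verified while those modules were unbuilt; this file restates it with the names
(definitionally the same statement). Planner p1's WANTED W1 / FSV Lemma 13. Does NOT close the item.

References: [ForbesShpilkaVolk2018] Lemma 13.
-/

-- layout Summits/ValiantsHypothesis/ValiantsHypothesis forces the duplicated namespace component
set_option linter.dupNamespace false

noncomputable section

namespace Summit.ValiantsHypothesis.ValiantsHypothesis.Theorems.BarrierLever.SuccinctHittingSetsForVP

namespace UniversalJoint

open Literature.Barriers.ValiantsHypothesis Literature.Computability.AlgebraicComplexity MvPolynomial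

/-- **Universal jointness, named form (FSV Lemma 13; p1's `UniversalJointness`):** if
`SuccinctHittingSetsForVP ℂ` then for some `b, n₀` and all `n ≥ n₀` there is a JOINTLY
`SmallCircuits`-succinct (`JointlySuccinct ℂ n q b G`) hitting set generator for
`Distinguishers ℂ n 1`. [cite: ForbesShpilkaVolk2018, Lemma 13] -/
theorem universalJointness_door (hQ : SuccinctHittingSetsForVP ℂ) :
    ∃ b n₀ : ℕ, ∀ n : ℕ, n₀ ≤ n → ∃ (q : ℕ) (G : degLEMonomials n → MvPolynomial (Fin q) ℂ),
      JointlySuccinct ℂ n q b G ∧ IsHittingSetGenerator (Distinguishers ℂ n 1) G :=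
  universalJointness hQ

end UniversalJoint

end Summit.ValiantsHypothesis.ValiantsHypothesis.Theorems.BarrierLever.SuccinctHittingSetsForVP

end
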